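import Mathlib.Analysis.SpecialFunctions.Pow.Real
import Mathlib.MeasureTheory.Integral.Bochner.Basic
import Literature.Probability.LatticeModels.IsingThermodynamics
import Literature.Probability.LatticeModels.GibbsSpecification
import Literature.Probability.LatticeModels.GibbsSpecificationProofs
import Literature.Probability.LatticeModels.GibbsSpecificationDLRProofs
import Literature.Probability.LatticeModels.PlusMinusStateGibbs
import HarnessLib

/-!
# Boundary-law mixtures of finite-volume Ising Gibbs states and the lattice-bootstrap rows

Topic `Probability/LatticeModels`, namespace `Literature.Probability.LatticeModels`.
Definition file (two definitions, proved API lemmas, no named facts) requested by route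
`LatticeSDPCertificates` of `CriticalPhenomena/Ising3DConformalLimit` (items
`stmt-CriticalPhenomena-5504` = `CertifiedWindow`, `stmt-CriticalPhenomena-5506` =
`CriticalStateFeasible`, which inline the same conjunction of hypothesis rows twice).

* `boundaryLawFunctional d L β ν : Finset (Site d) → ℝ`, the **level-`L` Gibbs-inside mixture
  functional with boundary law `ν`**: `A ↦ ∫ ⟨σ_A⟩^η_{B(L);β,0} ν(dη)`, the set-indexed correlations
  of the measure `ν γ_{B(L)}` obtained by resampling the box `B(L) = {-L,…,L}^d` from the
  zero-field Ising specification with the boundary condition drawn from `ν`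
  (Friedli–Velenik 2017, §6.2, eq. (6.12) and §6.3.1, `μπ_Λ`; Georgii 2011, Def. 1.23 / Rem. 1.24).
  These are exactly the finite-level feasible points of the "Gibbs-inside" relaxations of the
  lattice Ising bootstrap (Cho–Sun 2023, Def. 11/12: candidate moments obeying positivity,
  lattice symmetry and the spin-flip = DLR equations inside a finite domain), since a law on
  configurations that satisfies the single-box DLR equation for `B(L)` is of the form `ν γ_{B(L)}`.
  API: unfolding (`boundaryLawFunctional_apply`, `boundaryLawFunctional_eq_integral_spinCorr`),
  measurability of the integrand, `|·| ≤ 1`, value `1` at `A = ∅`, Dirac boundary laws give back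
  the fixed-boundary correlations, and the **DLR fixed-point property**: for an infinite-volume
  Gibbs measure `μ ∈ 𝒢(β,0)` the functional of `μ` is `A ↦ ⟨σ_A⟩_μ` at every level
  (`boundaryLawFunctional_eq_spinCorr_of_isGibbsMeasure`), in particular the plus state `μ⁺_{β,0}`
  reproduces `plusCorr d β 0` (`exists_isGibbsMeasure_boundaryLawFunctional_eq_plusCorr`).
* `LatticeBootstrapFeasible L cw Cw E : Prop` (`d = 3`, `β = β_c(3)`), the conjunction of the
  eight HYPOTHESIS ROWS that the route imposes on a level-`L` functional
  `E : Finset (Site 3) → ℝ` — copied verbatim from the antecedent of `CertifiedWindow` /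
  `CriticalStateFeasible` in `Summits/CriticalPhenomena/Ising3DConformalLimit/Theses/
  LatticeSDPCertificates.lean`, so that `LatticeBootstrapFeasible L cw Cw E ↔ ROWS` is `Iff.rfl`
  (`latticeBootstrapFeasible_iff`):
  (1) translation invariance inside `box 3 L`; (2) invariance under signed coordinate
  permutations (the hyperoctahedral point group); (3) reflection positivity
  `0 ≤ ∑_{a,b} c_a c_b E(A_a ∆ θ A_b)` for families `A_a ⊆ box 3 L ∩ {ℓ ≥ 0}` and the four lattice
  mirror types `(θ, ℓ)` — site plane `x_i = 0`, bond plane `x_i = 1/2`, diagonal `x_i = x_j`,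
  anti-diagonal `x_i = -x_j` (the matrix form `M_{A,B} = m(s_{A ∆ R(B)})` of Cho–Sun 2023,
  Def. 12, for the reflections of Fröhlich–Israel–Lieb–Simon 1978); (4) Griffiths' first
  inequality `0 ≤ E A`; (5)–(6) the Messager–Miracle-Solé pair rows along the axes and away from
  the diagonals (shapes of `messager_miracleSole`, `messager_miracleSole_diag`); (7) the Simon
  sphere rows `1 ≤ ∑_{y ∈ B(n) ∖ B(n-1)} 24 β_c(3) E{0,y}` for `1 ≤ n ≤ L` (`24 = 8d` at `d = 3`;
  shape of `sphereSum_twoPointPlus_criticalBeta_ge_one_of_peierls`); (8) the power window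
  `cw ‖x‖⁻² ≤ E{0,x} ≤ Cw ‖x‖⁻¹` for `x ≠ 0` in the box (shape of `criticalTwoPoint_bounds` at
  `d = 3`; `‖·‖` is the sup norm of `Site 3`). API: the `Iff.rfl` unfolding, the eight
  projections, monotonicity in the window constants, positivity of `E{0,x}`.

Design notes. `LatticeBootstrapFeasible` is deliberately NOT generalised (dimension, `β`, the
constant `24`, the exponents `-2`, `-1` are those of the route text): the requester needs
definitional agreement with the route's rows. `boundaryLawFunctional` is general in `d`, `L`, `β`
(zero field, as requested). For `A ⊄ box d L` the value of `boundaryLawFunctional` is the honest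
mixed moment `∫ ⟨σ_{A ∩ B(L)}⟩^η σ_{A ∖ B(L)}(η) ν(dη)` of `ν γ_{B(L)}` (no junk), but the route only
evaluates it on subsets of the box. Nothing here asserts that any particular `E` is feasible:
feasibility of the critical plus state is the route's item `CriticalStateFeasible`.

## References

* S. Friedli, Y. Velenik, *Statistical Mechanics of Lattice Systems*, CUP (2017), §6.2 eq. (6.12),
  §6.3.1 (Def. 6.12, Exercise 6.6), §10 (reflection positivity).
* H.-O. Georgii, *Gibbs Measures and Phase Transitions*, 2nd ed. (2011), Def. 1.23, Rem. 1.24.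
* M. Cho, X. Sun, *Bootstrap, Markov Chain Monte Carlo, and LP/SDP hierarchy for the lattice
  Ising model*, JHEP 11 (2023) 047, Def. 11 (`BS₁`), Def. 12 (`BS₂`), Thm. 5.
* J. Fröhlich, R. Israel, E. H. Lieb, B. Simon, *Phase transitions and reflection positivity. I*,
  Comm. Math. Phys. 62 (1978) 1–34.
* A. Messager, S. Miracle-Solé, J. Stat. Phys. 17 (1977) 245–262; B. Simon, Comm. Math. Phys. 77
  (1980) 111–126.
-/

namespace Literature.Probability.LatticeModels

open _root_.MeasureTheory Finset

/-! ### The mixture functional of a boundary law -/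

section BoundaryLaw

variable {d : ℕ}

/-- The **level-`L` Gibbs-inside mixture functional with boundary law `ν`** (zero field):
`boundaryLawFunctional d L β ν A = ∫ ⟨σ_A⟩^η_{B(L);β,0} ν(dη)`, the `ν`-average over boundary
conditions `η` of the finite-volume Ising correlations in the box `B(L) = {-L,…,L}^d` with
boundary condition fixed to `η`; equivalently the correlation `⟨σ_A⟩` of the measure
`ν γ_{B(L)}` (`ν` resampled inside `B(L)` from the Ising specification), Friedli–Velenik 2017,
§6.2, eq. (6.12) (`μ(A) = ∫ μ^ω_{Δ;β,h}(A) μ(dω)` is the statement that a Gibbs measure is a fixed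
point of this operation) and §6.3.1 (`μπ_Λ`). These functionals are the finite-level feasible
points of the Gibbs-inside lattice Ising bootstrap (Cho–Sun 2023, Def. 11–12).
[cite: FriedliVelenik2017, §6.2 eq. (6.12) and §6.3.1] -/
noncomputable def boundaryLawFunctional (d L : ℕ) (β : ℝ) (ν : Measure (SpinConfig (Site d))) :
    Finset (Site d) → ℝ :=
  fun A => ∫ η, isingCorr (zdGraph d) (box d L) β 0 (.fixed η) A ∂ν

/-- Unfolding of `boundaryLawFunctional` (Friedli–Velenik 2017, §6.2, eq. (6.12)).
[cite: FriedliVelenik2017, §6.2 eq. (6.12)] -/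
theorem boundaryLawFunctional_apply (L : ℕ) (β : ℝ) (ν : Measure (SpinConfig (Site d)))
    (A : Finset (Site d)) :
    boundaryLawFunctional d L β ν A = ∫ η, isingCorr (zdGraph d) (box d L) β 0 (.fixed η) A ∂ν :=
  rfl

/-- `boundaryLawFunctional` in terms of the Ising specification `γ_{B(L)}(· | η)`:
`∫ ⟨σ_A⟩_{γ_{B(L)}(·|η)} ν(dη)` (Friedli–Velenik 2017, §6.2.1, eq. (6.6) and §6.3.1).
[cite: FriedliVelenik2017, §6.2.1 eq. (6.6)] -/
theorem boundaryLawFunctional_eq_integral_spinCorr (L : ℕ) (β : ℝ)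
    (ν : Measure (SpinConfig (Site d))) (A : Finset (Site d)) :
    boundaryLawFunctional d L β ν A =
      ∫ η, spinCorr (isingSpecification (zdGraph d) β 0 (box d L) η) A ∂ν :=
  rfl

/-- The integrand `η ↦ ⟨σ_A⟩^η_{B(L);β,0}` of `boundaryLawFunctional` is measurable in the
boundary condition (Friedli–Velenik 2017, §6.3, property 2 after eq. (6.14): `ω ↦ μ^ω_Λ(A)` is
`𝓕_{Λᶜ}`-measurable; here via the specification property of the Ising kernels).
[cite: FriedliVelenik2017, §6.3 (property 2 after eq. (6.14))] -/
theorem measurable_isingCorr_fixed_box (L : ℕ) (β : ℝ) (A : Finset (Site d)) :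
    Measurable fun η : SpinConfig (Site d) => isingCorr (zdGraph d) (box d L) β 0 (.fixed η) A := by
  have hγ : IsSpecification (isingSpecification (zdGraph d) β 0) :=
    isSpecification_isingSpecification_zd_holds d β 0
  have hsm : StronglyMeasurable fun η : SpinConfig (Site d) =>
      ∫ σ, spinProduct A σ ∂(isingSpecification (zdGraph d) β 0 (box d L) η) :=
    (measurable_spinProduct A).stronglyMeasurable.integral_kernel
      (κ := (⟨isingSpecification (zdGraph d) β 0 (box d L), hγ.measurable_fun (box d L)⟩ :
        ProbabilityTheory.Kernel (SpinConfig (Site d)) (SpinConfig (Site d))))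
  exact hsm.measurable

/-- `|boundaryLawFunctional d L β ν A| ≤ 1` for a probability boundary law `ν`
(each `|⟨σ_A⟩^η_{B(L)}| ≤ 1`, Friedli–Velenik 2017, §3.6.1). [cite: FriedliVelenik2017, §3.6.1] -/
theorem abs_boundaryLawFunctional_le_one (L : ℕ) (β : ℝ) (ν : Measure (SpinConfig (Site d)))
    [IsProbabilityMeasure ν] (A : Finset (Site d)) :
    |boundaryLawFunctional d L β ν A| ≤ 1 := by
  have h := norm_integral_le_of_norm_le_const (μ := ν) (C := 1)
    (f := fun η : SpinConfig (Site d) => isingCorr (zdGraph d) (box d L) β 0 (.fixed η) A)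
    (Filter.Eventually.of_forall fun η => by
      rw [Real.norm_eq_abs]; exact abs_isingCorr_le_one (zdGraph d) (box d L) β 0 _ A)
  simpa [boundaryLawFunctional_apply, Real.norm_eq_abs] using h

/-- Normalisation: `boundaryLawFunctional d L β ν ∅ = 1` for a probability boundary law
(`⟨σ_∅⟩ = ⟨1⟩ = 1`, Friedli–Velenik 2017, §3.6.1; the unit-normalisation row of Cho–Sun 2023,
Def. 11). [cite: FriedliVelenik2017, §3.6.1] -/
theorem boundaryLawFunctional_empty (L : ℕ) (β : ℝ) (ν : Measure (SpinConfig (Site d)))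
    [IsProbabilityMeasure ν] : boundaryLawFunctional d L β ν ∅ = 1 := by
  have h1 : ∀ η : SpinConfig (Site d), isingCorr (zdGraph d) (box d L) β 0 (.fixed η) ∅ = 1 := by
    intro η
    simp [isingCorr, isingExpect, spinProduct]
  simp [boundaryLawFunctional_apply, h1]

/-- A Dirac boundary law gives back the fixed-boundary finite-volume correlations:
`boundaryLawFunctional d L β δ_η A = ⟨σ_A⟩^η_{B(L);β,0}` (Friedli–Velenik 2017, §6.2.1, eq. (6.6)).
[cite: FriedliVelenik2017, §6.2.1 eq. (6.6)] -/
theorem boundaryLawFunctional_dirac (L : ℕ) (β : ℝ) (η : SpinConfig (Site d)) (A : Finset (Site d)) :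
    boundaryLawFunctional d L β (Measure.dirac η) A =
      isingCorr (zdGraph d) (box d L) β 0 (.fixed η) A := by
  rw [boundaryLawFunctional_apply]
  exact integral_dirac' _ _ (measurable_isingCorr_fixed_box L β A).stronglyMeasurable

/-- **DLR fixed-point property** (Friedli–Velenik 2017, §6.2, eq. (6.12), and Exercise 6.6 with
Def. 6.12: `μπ_Λ(f) = μ(f)` for `μ ∈ 𝒢(π)`): if `μ` is an infinite-volume Gibbs measure of the
zero-field Ising model on `ℤ^d` at inverse temperature `β`, then at every level `L` the mixture
functional with boundary law `μ` is the correlation functional of `μ` itself,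
`boundaryLawFunctional d L β μ A = ⟨σ_A⟩_μ`. [cite: FriedliVelenik2017, §6.2 eq. (6.12)] -/
theorem boundaryLawFunctional_eq_spinCorr_of_isGibbsMeasure {β : ℝ}
    {μ : Measure (SpinConfig (Site d))}
    (hμ : IsGibbsMeasure (isingSpecification (zdGraph d) β 0) μ) (L : ℕ) (A : Finset (Site d)) :
    boundaryLawFunctional d L β μ A = spinCorr μ A := by
  haveI := hμ.isProbabilityMeasure
  have hγ : IsSpecification (isingSpecification (zdGraph d) β 0) :=
    isSpecification_isingSpecification_zd_holds d β 0
  rw [boundaryLawFunctional_eq_integral_spinCorr]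
  exact hμ.integral_integral_eq hγ (box d L) (integrable_spinProduct μ A)

/-- **The plus state is level-`L` feasible for every `L`, with its own correlations**: for
`β ≥ 0` there is a boundary law (the plus measure `μ⁺_{β,0} ∈ 𝒢(β,0)`,
`exists_plusMeasure_holds`) whose mixture functional at every level `L` is
`A ↦ ⟨σ_A⟩⁺_{β,0} = plusCorr d β 0 A` (Friedli–Velenik 2017, §6.2, eq. (6.12) for `μ⁺`, which is a
Gibbs measure by Thm. 6.26 / Lemma 6.7). [cite: FriedliVelenik2017, §6.2 eq. (6.12)] -/
theorem exists_isGibbsMeasure_boundaryLawFunctional_eq_plusCorr {β : ℝ} (hβ : 0 ≤ β) :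
    ∃ μ : Measure (SpinConfig (Site d)),
      IsGibbsMeasure (isingSpecification (zdGraph d) β 0) μ ∧ IsTranslationInvariantMeasure μ ∧
        ∀ (L : ℕ) (A : Finset (Site d)), boundaryLawFunctional d L β μ A = plusCorr d β 0 A := by
  obtain ⟨μ, hμ, hti, hcorr⟩ := exists_plusMeasure_holds (d := d) (β := β) (h := 0) hβ
  rw [mem_isingGibbsMeasures_iff] at hμ
  exact ⟨μ, hμ, hti, fun L A => by
    rw [boundaryLawFunctional_eq_spinCorr_of_isGibbsMeasure hμ L A, hcorr A]⟩

end BoundaryLaw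

/-! ### The hypothesis rows of the lattice bootstrap at `d = 3`, `β = β_c(3)` -/

section Rows

/-- **Lattice-bootstrap feasibility rows** for a level-`L` functional `E : Finset (Site 3) → ℝ`
(thought of as `A ↦` a candidate value of `⟨σ_A⟩` for `A ⊆ box 3 L`) with window constants
`cw, Cw`, at `d = 3` and `β = β_c(3)`; the conjunction, verbatim, of the hypothesis rows of
`CertifiedWindow` / `CriticalStateFeasible` of route `LatticeSDPCertificates`:
1. translation invariance inside the box: `E (A + v) = E A` whenever `A, A + v ⊆ box 3 L`;
2. invariance under signed coordinate permutations `x ↦ (s_i x_{π i})_i`;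
3. reflection positivity in the matrix form of Cho–Sun 2023, Def. 12
   (`M_{A,B} = m(s_{A ∆ R(B)})` positive semidefinite over sets in the closed half-space), for the
   four lattice mirror types of Fröhlich–Israel–Lieb–Simon 1978: site plane `x_i = 0`
   (`θ x = update x i (-x i)`, `ℓ x = x i`), bond plane `x_i = 1/2`
   (`θ x = update x i (1 - x i)`, `ℓ x = 2 x i - 1`), diagonal plane `x_i = x_j`
   (`θ x = x ∘ swap i j`, `ℓ x = x i - x j`) and anti-diagonal plane `x_i = -x_j`
   (`θ x = update (update x i (-x j)) j (-x i)`, `ℓ x = x i + x j`), `i ≠ j`: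
   `0 ≤ ∑_a ∑_b c_a c_b E (A_a ∆ θ(A_b))` for all finite families `A_a ⊆ box 3 L ∩ {ℓ ≥ 0}`;
4. Griffiths' first inequality `0 ≤ E A` for `A ⊆ box 3 L`;
5. Messager–Miracle-Solé along the axes: `E {0, x + e_i} ≤ E {0, x}` for `x ≠ 0`, `0 ≤ x_i`
   (both points in the box);
6. Messager–Miracle-Solé away from the diagonals: `E {0, x + e_i - e_j} ≤ E {0, x}` for `i ≠ j`,
   `x ≠ 0`, `x_j ≤ x_i` (both points in the box);
7. Simon sphere rows (criticality): `1 ≤ ∑_{y ∈ box 3 n ∖ box 3 (n-1)} 24 β_c(3) E {0, y}` for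
   `1 ≤ n ≤ L`;
8. power window: `cw ‖x‖^(-2) ≤ E {0, x} ≤ Cw ‖x‖^(-1)` for `x ≠ 0` in `box 3 L` (sup norm).
Rows 1, 2, 4–8 are the lattice-symmetry, positivity and a-priori rows, row 3 the reflection
positivity rows of the `BS₂` hierarchy of Cho–Sun 2023, Def. 12 (with the MMS, Simon and window
rows added by the route as further valid inequalities of the critical state).
[cite: ChoSun2023, Def. 12 (rows of BS₂); FrohlichIsraelLiebSimon1978 (mirror types)] -/
def LatticeBootstrapFeasible (L : ℕ) (cw Cw : ℝ) (E : Finset (Site 3) → ℝ) : Prop :=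
  (∀ (A : Finset (Site 3)) (v : Site 3), A ⊆ box 3 L → A.image (· + v) ⊆ box 3 L →
      E (A.image (· + v)) = E A) ∧
  (∀ (A : Finset (Site 3)) (π : Equiv.Perm (Fin 3)) (s : Fin 3 → ℤˣ), A ⊆ box 3 L →
      E (A.image (fun x i => (s i : ℤ) * x (π i))) = E A) ∧
  (∀ (θ : Site 3 → Site 3) (ℓ : Site 3 → ℤ),
      (∃ i j : Fin 3, i ≠ j ∧
        ((θ = fun x => Function.update x i (-x i)) ∧ (ℓ = fun x => x i) ∨
         (θ = fun x => Function.update x i (1 - x i)) ∧ (ℓ = fun x => 2 * x i - 1) ∨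
         (θ = fun x => x ∘ Equiv.swap i j) ∧ (ℓ = fun x => x i - x j) ∨
         (θ = fun x => Function.update (Function.update x i (-x j)) j (-x i)) ∧
           (ℓ = fun x => x i + x j))) →
      ∀ (m : ℕ) (A : Fin m → Finset (Site 3)) (c : Fin m → ℝ),
        (∀ a, A a ⊆ box 3 L ∧ ∀ p ∈ A a, 0 ≤ ℓ p) →
        0 ≤ ∑ a, ∑ b, c a * c b * E (symmDiff (A a) ((A b).image θ))) ∧
  (∀ A : Finset (Site 3), A ⊆ box 3 L → 0 ≤ E A) ∧
  (∀ (x : Site 3) (i : Fin 3), x ≠ 0 → 0 ≤ x i → x ∈ box 3 L → x + Pi.single i 1 ∈ box 3 L →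
      E {0, x + Pi.single i 1} ≤ E {0, x}) ∧
  (∀ (x : Site 3) (i j : Fin 3), i ≠ j → x ≠ 0 → x j ≤ x i → x ∈ box 3 L →
      x + Pi.single i 1 - Pi.single j 1 ∈ box 3 L →
      E {0, x + Pi.single i 1 - Pi.single j 1} ≤ E {0, x}) ∧
  (∀ n : ℕ, 1 ≤ n → n ≤ L →
      1 ≤ ∑ y ∈ box 3 n \ box 3 (n - 1), 24 * criticalBeta 3 * E {0, y}) ∧
  (∀ x : Site 3, x ∈ box 3 L → x ≠ 0 →
      cw * (‖x‖ : ℝ) ^ (-(2:ℝ)) ≤ E {0, x} ∧ E {0, x} ≤ Cw * (‖x‖ : ℝ) ^ (-(1:ℝ)))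

variable {L : ℕ} {cw Cw : ℝ} {E : Finset (Site 3) → ℝ}

/-- `LatticeBootstrapFeasible L cw Cw E` unfolds, by `Iff.rfl`, to the conjunction of hypothesis
rows written exactly as in `CertifiedWindow` / `CriticalStateFeasible` of route
`LatticeSDPCertificates` (one line, fully qualified names shortened) (Cho–Sun 2023, Def. 12).
[cite: ChoSun2023, Def. 12] -/
theorem latticeBootstrapFeasible_iff (L : ℕ) (cw Cw : ℝ) (E : Finset (Site 3) → ℝ) :
    LatticeBootstrapFeasible L cw Cw E ↔
      ((∀ (A : Finset (Site 3)) (v : Site 3), A ⊆ box 3 L → A.image (· + v) ⊆ box 3 L → E (A.image (· + v)) = E A) ∧ (∀ (A : Finset (Site 3)) (π : Equiv.Perm (Fin 3)) (s : Fin 3 → ℤˣ), A ⊆ box 3 L → E (A.image (fun x i => (s i : ℤ) * x (π i))) = E A) ∧ (∀ (θ : Site 3 → Site 3) (ℓ : Site 3 → ℤ), (∃ i j : Fin 3, i ≠ j ∧ ((θ = fun x => Function.update x i (-x i)) ∧ (ℓ = fun x => x i) ∨ (θ = fun x => Function.update x i (1 - x i)) ∧ (ℓ = fun x => 2 * x i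 - 1) ∨ (θ = fun x => x ∘ Equiv.swap i j) ∧ (ℓ = fun x => x i - x j) ∨ (θ = fun x => Function.update (Function.update x i (-x j)) j (-x i)) ∧ (ℓ = fun x => x i + x j))) → ∀ (m : ℕ) (A : Fin m → Finset (Site 3)) (c : Fin m → ℝ), (∀ a, A a ⊆ box 3 L ∧ ∀ p ∈ A a, 0 ≤ ℓ p) → 0 ≤ ∑ a, ∑ b, c a * c b * E (symmDiff (A a) ((A b).image θ))) ∧ (∀ A : Finset (Site 3), A ⊆ box 3 L → 0 ≤ E A) ∧ (∀ (x : Site 3) (i : Fin 3), x ≠ 0 → 0 ≤ x i → x ∈ box 3 L → x + Pi.single i 1 ∈ box 3 L → E {0, x + Pi.single i 1} ≤ E {0, x}) ∧ (∀ (x : Site 3) (i j : Fin 3), i ≠ j → x ≠ 0 → x j ≤ x i → x ∈ box 3 L → x + Pi.single i 1 - Pi.single j 1 ∈ box 3 L → E {0, x + Pi.single i 1 - Pi.single j 1} ≤ E {0, x}) ∧ (∀ n : ℕ, 1 ≤ n → n ≤ L → 1 ≤ ∑ y ∈ box 3 n \ box 3 (n - 1), 24 * criticalBeta 3 * E {0,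 y}) ∧ (∀ x : Site 3, x ∈ box 3 L → x ≠ 0 → cw * (‖x‖ : ℝ) ^ (-(2:ℝ)) ≤ E {0, x} ∧ E {0, x} ≤ Cw * (‖x‖ : ℝ) ^ (-(1:ℝ)))) :=
  Iff.rfl

namespace LatticeBootstrapFeasible

/-- Row 1 (translation invariance inside the box; the lattice-symmetry row of Cho–Sun 2023,
Def. 12). [cite: ChoSun2023, Def. 12 (Symmetry)] -/
theorem translation_invariant (h : LatticeBootstrapFeasible L cw Cw E) {A : Finset (Site 3)}
    {v : Site 3} (hA : A ⊆ box 3 L) (hAv : A.image (· + v) ⊆ box 3 L) :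
    E (A.image (· + v)) = E A :=
  h.1 A v hA hAv

/-- Row 2 (invariance under signed coordinate permutations; the lattice-symmetry row of
Cho–Sun 2023, Def. 12). [cite: ChoSun2023, Def. 12 (Symmetry)] -/
theorem signedPerm_invariant (h : LatticeBootstrapFeasible L cw Cw E) {A : Finset (Site 3)}
    (π : Equiv.Perm (Fin 3)) (s : Fin 3 → ℤˣ) (hA : A ⊆ box 3 L) :
    E (A.image (fun x i => (s i : ℤ) * x (π i))) = E A :=
  h.2.1 A π s hA

/-- Row 3 (reflection positivity for the four lattice mirror types, matrix form of Cho–Sun 2023,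
Def. 12; mirrors of Fröhlich–Israel–Lieb–Simon 1978). [cite: ChoSun2023, Def. 12 (Reflection positivity)] -/
theorem reflectionPositive (h : LatticeBootstrapFeasible L cw Cw E) {θ : Site 3 → Site 3}
    {ℓ : Site 3 → ℤ}
    (hθ : ∃ i j : Fin 3, i ≠ j ∧
      ((θ = fun x => Function.update x i (-x i)) ∧ (ℓ = fun x => x i) ∨
       (θ = fun x => Function.update x i (1 - x i)) ∧ (ℓ = fun x => 2 * x i - 1) ∨
       (θ = fun x => x ∘ Equiv.swap i j) ∧ (ℓ = fun x => x i - x j) ∨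
       (θ = fun x => Function.update (Function.update x i (-x j)) j (-x i)) ∧
         (ℓ = fun x => x i + x j)))
    {m : ℕ} (A : Fin m → Finset (Site 3)) (c : Fin m → ℝ)
    (hA : ∀ a, A a ⊆ box 3 L ∧ ∀ p ∈ A a, 0 ≤ ℓ p) :
    0 ≤ ∑ a, ∑ b, c a * c b * E (symmDiff (A a) ((A b).image θ)) :=
  h.2.2.1 θ ℓ hθ m A c hA

/-- Row 4 (Griffiths' first inequality `0 ≤ E A` on box sets; Friedli–Velenik 2017, Thm. 3.20).
[cite: FriedliVelenik2017, Thm. 3.20] -/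
theorem nonneg (h : LatticeBootstrapFeasible L cw Cw E) {A : Finset (Site 3)} (hA : A ⊆ box 3 L) :
    0 ≤ E A :=
  h.2.2.2.1 A hA

/-- Row 5 (Messager–Miracle-Solé monotonicity along a coordinate axis, pair form; shape of
`messager_miracleSole`). [cite: MessagerMiracleSoleJSP1977, main theorem] -/
theorem mms_axis (h : LatticeBootstrapFeasible L cw Cw E) {x : Site 3} {i : Fin 3} (hx : x ≠ 0)
    (hxi : 0 ≤ x i) (hxL : x ∈ box 3 L) (hxL' : x + Pi.single i 1 ∈ box 3 L) :
    E {0, x + Pi.single i 1} ≤ E {0, x} :=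
  h.2.2.2.2.1 x i hx hxi hxL hxL'

/-- Row 6 (Messager–Miracle-Solé monotonicity away from a diagonal plane, pair form; shape of
`messager_miracleSole_diag`). [cite: MessagerMiracleSoleJSP1977, main theorem] -/
theorem mms_diag (h : LatticeBootstrapFeasible L cw Cw E) {x : Site 3} {i j : Fin 3} (hij : i ≠ j)
    (hx : x ≠ 0) (hxji : x j ≤ x i) (hxL : x ∈ box 3 L)
    (hxL' : x + Pi.single i 1 - Pi.single j 1 ∈ box 3 L) :
    E {0, x + Pi.single i 1 - Pi.single j 1} ≤ E {0, x} :=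
  h.2.2.2.2.2.1 x i j hij hx hxji hxL hxL'

/-- Row 7 (Simon sphere rows `1 ≤ ∑_{‖y‖∞ = n} 24 β_c(3) E{0,y}`, `1 ≤ n ≤ L`; shape of
`sphereSum_twoPointPlus_criticalBeta_ge_one_of_peierls`, Duminil-Copin 2019, proof of Thm. 4.8).
[cite: DuminilCopin2019, proof of Thm. 4.8] -/
theorem simon_sphere (h : LatticeBootstrapFeasible L cw Cw E) {n : ℕ} (hn : 1 ≤ n) (hnL : n ≤ L) :
    1 ≤ ∑ y ∈ box 3 n \ box 3 (n - 1), 24 * criticalBeta 3 * E {0, y} :=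
  h.2.2.2.2.2.2.1 n hn hnL

/-- Row 8 (the power window `cw ‖x‖⁻² ≤ E{0,x} ≤ Cw ‖x‖⁻¹`, shape of `criticalTwoPoint_bounds` at
`d = 3`; Duminil-Copin 2019, Thm. 4.8). [cite: DuminilCopin2019, Thm. 4.8] -/
theorem window (h : LatticeBootstrapFeasible L cw Cw E) {x : Site 3} (hxL : x ∈ box 3 L)
    (hx : x ≠ 0) :
    cw * (‖x‖ : ℝ) ^ (-(2:ℝ)) ≤ E {0, x} ∧ E {0, x} ≤ Cw * (‖x‖ : ℝ) ^ (-(1:ℝ)) :=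
  h.2.2.2.2.2.2.2 x hxL hx

/-- The rows are monotone in the window constants: shrinking `cw` and enlarging `Cw` preserves
feasibility (only row 8 involves them) (Duminil-Copin 2019, Thm. 4.8, form of the bounds).
[cite: DuminilCopin2019, Thm. 4.8] -/
theorem mono (h : LatticeBootstrapFeasible L cw Cw E) {cw' Cw' : ℝ} (hcw : cw' ≤ cw)
    (hCw : Cw ≤ Cw') : LatticeBootstrapFeasible L cw' Cw' E := by
  refine ⟨h.1, h.2.1, h.2.2.1, h.2.2.2.1, h.2.2.2.2.1, h.2.2.2.2.2.1, h.2.2.2.2.2.2.1, ?_⟩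
  intro x hxL hx
  obtain ⟨hlo, hhi⟩ := h.window hxL hx
  have h2 : 0 ≤ (‖x‖ : ℝ) ^ (-(2:ℝ)) := Real.rpow_nonneg (norm_nonneg x) _
  have h1 : 0 ≤ (‖x‖ : ℝ) ^ (-(1:ℝ)) := Real.rpow_nonneg (norm_nonneg x) _
  exact ⟨(mul_le_mul_of_nonneg_right hcw h2).trans hlo, hhi.trans (mul_le_mul_of_nonneg_right hCw h1)⟩

/-- With a positive lower window constant every pair value `E{0,x}`, `x ≠ 0` in the box, is
strictly positive (row 8; Duminil-Copin 2019, Thm. 4.8, lower bound). [cite: DuminilCopin2019, Thm. 4.8] -/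
theorem twoPoint_pos (h : LatticeBootstrapFeasible L cw Cw E) (hcw : 0 < cw) {x : Site 3}
    (hxL : x ∈ box 3 L) (hx : x ≠ 0) : 0 < E {0, x} := by
  have hnorm : 0 < (‖x‖ : ℝ) := norm_pos_iff.2 hx
  exact (mul_pos hcw (Real.rpow_pos_of_pos hnorm _)).trans_le (h.window hxL hx).1

end LatticeBootstrapFeasible

end Rows

end Literature.Probability.LatticeModels
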